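import Summits.CriticalPhenomena.PercolationContinuityZ3.Theorems.PercNearOneGluingNoHeavyLowerTailIncStarTwoPortStepNear
import Summits.CriticalPhenomena.PercolationContinuityZ3.Theorems.PercNearOneGluingNoHeavyLowerTailIncStarTwoPortStepFar
import Summits.CriticalPhenomena.PercolationContinuityZ3.Theorems.PercNearOneGluingNoHeavyLowerTailIncStarBranchLemma
import HarnessLib

/-!
# The TWO-PORT branch lemma (H), IV: the induction over the forest

Support file for the Sahi programme (`--supports stmt-CriticalPhenomena-4575`, prover prim-sahi-p2 gen 21).  No definitions, no named
facts, no sorries; standard axioms.  Memo `run/shared/lean/prim/prim-sahi/prim-sahi-p2/gen21/THEOREM-H.md` §1, `PROOF-E3.md` §31.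

**Theorem `twoPortBranchLemma` ((H) on every apex-forest).**  For product Bernoulli percolation `P = prodBernoulli w` on the pairs of
`Fin n` with root `s`: if the environment `fromEdgeSet {z | s ∉ z ∧ w z ≠ 0}` is acyclic, then for every `u` (the root allowed), every
`v ≠ s` and all `b, c`,
  `P({s↔u} ∩ {s↔v}ᶜ ∩ {b↔v}) · P({s↔c} ∪ {u↔c} ∪ {v↔c})`
    `≤ P({s↔u} ∩ {s↔v}ᶜ ∩ {b↔v} ∩ ({s↔c} ∪ {u↔c} ∪ {v↔c})) + P({s↔u} ∩ {s↔v}ᶜ ∩ {b↔v} ∩ ({s↔c} ∪ {u↔c}))`.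
The instance `(u, b) = (s, v)` is the branch lemma (Br) (`…IncStarBranchLemma`); the general instance is the two-port inequality behind
CONJECTURE Θ₂ / B-cyc of the memo: with `e = s(u,v)` it says that, given that `e` is pivotal for `{s↔b}` from the `u`-side, the expected
number of root connections of `c` with and without `e` is at least the unconditional probability that `c` meets `{s,u,v}`.

`twoPortBranchLemma_local` is the sharper form in which only the COMPONENT of the unrooted port `v` has to be cycle-free (the proof never looks
at the other components).

**Proof.**  Induction on the number of positive environment pairs.  `u = v`: the event is empty.  `c = v`: `X₃ = Ω`.  `v` without
environment pairs (`twoPort_base`): `b ≠ v` makes the event empty, and for `b = v ≠ c` the blocks `{s,v}` / `{v}ᶜ` are independent and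
Harris gives `P(s↔u in B)·P(X) ≤ P({s↔u in B} ∩ X)`.  Otherwise peel an environment pair `e₁ = s(v, x')` at `v` — the first edge of the
tree path `v → u` if `u` lies in the tree of `v`, any edge at `v` if not — whose `v`-side `L` then misses `s, x', u`
(`IncStar.apexForest_cross`), and apply the bridge step of `…IncStarTwoPortStepNear/Far` in the four cases `b, c ∈ L / ∉ L`, each fed
with one instance of the induction hypothesis for `w[e₁↦0]` (`IncStar.envGraph_update_le`, fewer positive pairs).  ∎
-/

noncomputable section

namespace Summit.CriticalPhenomena.PercolationContinuityZ3.Theorems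

namespace IncStar

open MeasureTheory Set Literature.Probability.Percolation Literature.Probability.LatticeModels EdgeInduction
open scoped Classical

variable {n : ℕ}

/-- (H) when the two ports coincide: the event `{s↔u} ∩ {s↔u}ᶜ` is empty. [this work] -/
theorem twoPort_of_eq (w : Sym2 (Fin n) → unitInterval) (s u b c : Fin n) :
    (prodBernoulli w).real (openConn s u ∩ (openConn s u)ᶜ ∩ openConn b u) *
        (prodBernoulli w).real (openConn s c ∪ openConn u c ∪ openConn u c)
      ≤ (prodBernoulli w).real (openConn s u ∩ (openConn s u)ᶜ ∩ openConn b u ∩ (openConn s c ∪ openConn u c ∪ openConn u c))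
        + (prodBernoulli w).real (openConn s u ∩ (openConn s u)ᶜ ∩ openConn b u ∩ (openConn s c ∪ openConn u c)) := by
  rw [Set.inter_compl_self, Set.empty_inter, Set.empty_inter, Set.empty_inter, measureReal_empty, zero_mul, zero_add]

/-- (H) when the plain target is the unrooted port (`c = v`): `X₃ ⊇ {v↔v} = Ω`. [this work] -/
theorem twoPort_of_target_eq_port (w : Sym2 (Fin n) → unitInterval) (s u v b : Fin n) :
    (prodBernoulli w).real (openConn s u ∩ (openConn s v)ᶜ ∩ openConn b v) *
        (prodBernoulli w).real (openConn s v ∪ openConn u v ∪ openConn v v)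
      ≤ (prodBernoulli w).real (openConn s u ∩ (openConn s v)ᶜ ∩ openConn b v ∩ (openConn s v ∪ openConn u v ∪ openConn v v))
        + (prodBernoulli w).real (openConn s u ∩ (openConn s v)ᶜ ∩ openConn b v ∩ (openConn s v ∪ openConn u v)) := by
  have huniv : (openConn s v ∪ openConn u v ∪ openConn v v : Set (BondConfig (Fin n))) = Set.univ :=
    Set.eq_univ_of_forall fun _ => Or.inr (SimpleGraph.Reachable.refl v)
  rw [huniv, Set.inter_univ, probReal_univ, mul_one]
  linarith [(measureReal_nonneg : 0 ≤ (prodBernoulli w).real (openConn s u ∩ (openConn s v)ᶜ ∩ openConn b v ∩ (openConn s v ∪ openConn u v)))]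

/-- **(H), base**: the unrooted port `v` has no positive environment pair. [this work] -/
theorem twoPort_base (w : Sym2 (Fin n) → unitInterval) {s u v : Fin n} (b c : Fin n) (hvs : v ≠ s) (huv : u ≠ v)
    (hiso : ∀ y : Fin n, y ≠ v → y ≠ s → w s(v, y) = 0) :
    (prodBernoulli w).real (openConn s u ∩ (openConn s v)ᶜ ∩ openConn b v) *
        (prodBernoulli w).real (openConn s c ∪ openConn u c ∪ openConn v c)
      ≤ (prodBernoulli w).real (openConn s u ∩ (openConn s v)ᶜ ∩ openConn b v ∩ (openConn s c ∪ openConn u c ∪ openConn v c))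
        + (prodBernoulli w).real (openConn s u ∩ (openConn s v)ᶜ ∩ openConn b v ∩ (openConn s c ∪ openConn u c)) := by
  by_cases hcv : c = v
  · subst hcv; exact twoPort_of_target_eq_port w s u c b
  set L : Set (Fin n) := {v} with hL
  have hsL : s ∉ L := fun h => hvs (Set.mem_singleton_iff.1 h).symm
  have hvL : v ∈ L := Set.mem_singleton v
  have huL : u ∉ L := fun h => huv (Set.mem_singleton_iff.1 h)
  have hcL : c ∉ L := fun h => hcv (Set.mem_singleton_iff.1 h)
  have hcross : ∀ x y : Fin n, x ∈ L → y ∉ L → y ≠ s → w s(x, y) = 0 := by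
    intro x y hx hy hys
    rw [Set.mem_singleton_iff.1 hx]
    exact hiso y (fun h => hy (h ▸ Set.mem_singleton v)) hys
  set G : Set (BondConfig (Fin n)) := {ω | ∀ e', w e' = 0 → e' ∉ ω}
  have hG1 : (prodBernoulli w).real G = 1 := real_sureClosed w
  have hωG : ∀ ω ∈ G, ∀ x y : Fin n, x ∈ L → y ∉ L → y ≠ s → s(x, y) ∉ ω :=
    fun ω hω x y hx hy hys => hω _ (hcross x y hx hy hys)
  set U : Set (BondConfig (Fin n)) := openConn s u ∩ (openConn s v)ᶜ ∩ openConn b v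
  set X3 : Set (BondConfig (Fin n)) := openConn s c ∪ openConn u c ∪ openConn v c
  set X2 : Set (BondConfig (Fin n)) := openConn s c ∪ openConn u c
  by_cases hbv : b = v
  swap
  · -- `b ≠ v`: the event is empty
    have hbL : b ∉ L := fun h => hbv (Set.mem_singleton_iff.1 h)
    have h0 : (prodBernoulli w).real U = 0 := by
      rw [real_congr_of_sure hG1 (A' := (∅ : Set (BondConfig (Fin n))))
        (fun ω hω => ⟨fun hA => (twoPort_mem_U_far L hsL hvL (hωG ω hω) hbL hA).elim, fun hA => (Set.notMem_empty _ hA).elim⟩),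
        measureReal_empty]
    rw [h0, zero_mul]
    exact add_nonneg measureReal_nonneg measureReal_nonneg
  subst hbv
  -- `b = v ≠ c`: independence of the blocks `{s, v}` and `{v}ᶜ`, and Harris in the far block
  set SAv : Set (BondConfig (Fin n)) := openConnIn (insert s L) s b
  set SBu : Set (BondConfig (Fin n)) := openConnIn Lᶜ s u
  set SBc : Set (BondConfig (Fin n)) := openConnIn Lᶜ s c
  set NBuc : Set (BondConfig (Fin n)) := openConnIn Lᶜ u c
  have hm : ∀ X : Set (BondConfig (Fin n)), MeasurableSet X := fun _ => MeasurableSet.of_discrete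
  have hbb : ∀ ω : BondConfig (Fin n), ω ∈ openConnIn (insert s L) b b := fun ω =>
    ⟨Set.mem_insert_of_mem s hvL, Set.mem_insert_of_mem s hvL, SimpleGraph.Reachable.refl _⟩
  have hdU : DeterminedBy (Set.univ \ SAv) {z : Sym2 (Fin n) | ¬ z.IsDiag ∧ ∀ x ∈ z, x ∈ insert s L} := by
    have h1 := IncStarCutVertex.determinedBy_openConnIn_offDiag (insert s L) s b
    have h2 := determinedBy_univ {z : Sym2 (Fin n) | ¬ z.IsDiag ∧ ∀ x ∈ z, x ∈ insert s L}
    rw [determinedBy_iff] at h1 h2 ⊢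
    intro ω ω' h
    rw [Set.mem_sdiff, Set.mem_sdiff, h1 ω ω' h, h2 ω ω' h]
  have hdC : DeterminedBy (SBu ∩ (SBc ∪ NBuc)) {z : Sym2 (Fin n) | ¬ z.IsDiag ∧ ∀ x ∈ z, x ∈ Lᶜ} := by
    have h1 := IncStarCutVertex.determinedBy_openConnIn_offDiag Lᶜ s u
    have h2 := IncStarCutVertex.determinedBy_openConnIn_offDiag Lᶜ s c
    have h3 := IncStarCutVertex.determinedBy_openConnIn_offDiag Lᶜ u c
    rw [determinedBy_iff] at h1 h2 h3 ⊢
    intro ω ω' h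
    simp only [Set.mem_inter_iff, Set.mem_union]
    rw [h1 ω ω' h, h2 ω ω' h, h3 ω ω' h]
  have m1 : (prodBernoulli w).real U = (prodBernoulli w).real (Set.univ \ SAv) * (prodBernoulli w).real SBu := by
    rw [← indep_blocks w L s hdU (IncStarCutVertex.determinedBy_openConnIn_offDiag Lᶜ s u)]
    refine real_congr_of_sure hG1 fun ω hω => ?_
    rw [twoPort_mem_U_near L hsL hvL huL (hωG ω hω) hvL]
    have := hbb ω
    simp only [Set.mem_inter_iff, Set.mem_sdiff, Set.mem_univ, true_and]
    tauto
  have m2 : (prodBernoulli w).real X3 = (prodBernoulli w).real (SBc ∪ NBuc) :=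
    real_congr_of_sure hG1 fun ω hω => by rw [twoPort_mem_X3_far L hsL hvL huL (hωG ω hω) hcL, Set.mem_union]
  have m3 : (prodBernoulli w).real (U ∩ X3) = (prodBernoulli w).real (Set.univ \ SAv) * (prodBernoulli w).real (SBu ∩ (SBc ∪ NBuc)) := by
    rw [← indep_blocks w L s hdU hdC]
    refine real_congr_of_sure hG1 fun ω hω => ?_
    rw [Set.mem_inter_iff, twoPort_mem_U_near L hsL hvL huL (hωG ω hω) hvL, twoPort_mem_X3_far L hsL hvL huL (hωG ω hω) hcL]
    have := hbb ω
    simp only [Set.mem_inter_iff, Set.mem_sdiff, Set.mem_univ, true_and, Set.mem_union]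
    tauto
  have m4 : (prodBernoulli w).real (U ∩ X2) = (prodBernoulli w).real (Set.univ \ SAv) * (prodBernoulli w).real (SBu ∩ (SBc ∪ NBuc)) := by
    rw [← indep_blocks w L s hdU hdC]
    refine real_congr_of_sure hG1 fun ω hω => ?_
    rw [Set.mem_inter_iff, twoPort_mem_U_near L hsL hvL huL (hωG ω hω) hvL, twoPort_X2_far L hsL huL (hωG ω hω) hcL]
    have := hbb ω
    simp only [Set.mem_inter_iff, Set.mem_sdiff, Set.mem_univ, true_and, Set.mem_union]
    tauto
  have hupS : ∀ x y : Fin n, IsUpperSet (openConnIn Lᶜ x y : Set (BondConfig (Fin n))) := fun x y => isUpperSet_openConnIn _ x y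
  have harris : (prodBernoulli w).real SBu * (prodBernoulli w).real (SBc ∪ NBuc) ≤ (prodBernoulli w).real (SBu ∩ (SBc ∪ NBuc)) :=
    prodBernoulli_harris w (hupS s u) ((hupS s c).union (hupS u c)) (hm _) (hm _)
  rw [m1, m2, m3, m4]
  have hA : 0 ≤ (prodBernoulli w).real (Set.univ \ SAv) := measureReal_nonneg
  nlinarith [mul_le_mul_of_nonneg_left harris hA,
    mul_nonneg hA (measureReal_nonneg : 0 ≤ (prodBernoulli w).real (SBu ∩ (SBc ∪ NBuc)))]

/-- **THE TWO-PORT BRANCH LEMMA (H), local form**: it suffices that no cycle of the environment passes through the component of the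
unrooted port `v` (the other components may carry cycles). [this work] -/
theorem twoPortBranchLemma_local (w : Sym2 (Fin n) → unitInterval) {s : Fin n} (u v b c : Fin n) (hvs : v ≠ s)
    (hloc : ∀ ⦃x : Fin n⦄, (SimpleGraph.fromEdgeSet {z : Sym2 (Fin n) | s ∉ z ∧ w z ≠ 0}).Reachable v x →
      ∀ (p : (SimpleGraph.fromEdgeSet {z : Sym2 (Fin n) | s ∉ z ∧ w z ≠ 0}).Walk x x), ¬ p.IsCycle) :
    (prodBernoulli w).real (openConn s u ∩ (openConn s v)ᶜ ∩ openConn b v) *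
        (prodBernoulli w).real (openConn s c ∪ openConn u c ∪ openConn v c)
      ≤ (prodBernoulli w).real (openConn s u ∩ (openConn s v)ᶜ ∩ openConn b v ∩ (openConn s c ∪ openConn u c ∪ openConn v c))
        + (prodBernoulli w).real (openConn s u ∩ (openConn s v)ᶜ ∩ openConn b v ∩ (openConn s c ∪ openConn u c)) := by
  suffices hN : ∀ (N : ℕ) (w : Sym2 (Fin n) → unitInterval) (u v b c : Fin n), v ≠ s →
      (∀ ⦃x : Fin n⦄, (SimpleGraph.fromEdgeSet {z : Sym2 (Fin n) | s ∉ z ∧ w z ≠ 0}).Reachable v x →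
        ∀ (p : (SimpleGraph.fromEdgeSet {z : Sym2 (Fin n) | s ∉ z ∧ w z ≠ 0}).Walk x x), ¬ p.IsCycle) →
      (Finset.univ.filter fun z : Sym2 (Fin n) => ¬ z.IsDiag ∧ s ∉ z ∧ w z ≠ 0).card ≤ N →
      (prodBernoulli w).real (openConn s u ∩ (openConn s v)ᶜ ∩ openConn b v) *
          (prodBernoulli w).real (openConn s c ∪ openConn u c ∪ openConn v c)
        ≤ (prodBernoulli w).real (openConn s u ∩ (openConn s v)ᶜ ∩ openConn b v ∩ (openConn s c ∪ openConn u c ∪ openConn v c))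
          + (prodBernoulli w).real (openConn s u ∩ (openConn s v)ᶜ ∩ openConn b v ∩ (openConn s c ∪ openConn u c)) from
    hN _ w u v b c hvs hloc le_rfl
  intro N
  induction N with
  | zero =>
    intro w u v b c hvs _ hN
    by_cases huv : u = v
    · subst huv; exact twoPort_of_eq w s u b c
    refine twoPort_base w b c hvs huv fun y hyv hys => ?_
    by_contra hw
    have hmem : s(v, y) ∈ Finset.univ.filter (fun z : Sym2 (Fin n) => ¬ z.IsDiag ∧ s ∉ z ∧ w z ≠ 0) := by
      simp only [Finset.mem_filter, Finset.mem_univ, true_and, Sym2.mk_isDiag_iff, Sym2.mem_iff]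
      exact ⟨fun h => hyv h.symm, fun h => h.elim (fun h => hvs h.symm) (fun h => hys h.symm), hw⟩
    have := Finset.card_pos.2 ⟨_, hmem⟩
    omega
  | succ N ih =>
    intro w u v b c hvs hloc hN
    by_cases huv : u = v
    · subst huv; exact twoPort_of_eq w s u b c
    by_cases hiso : ∀ y : Fin n, y ≠ v → y ≠ s → w s(v, y) = 0
    · exact twoPort_base w b c hvs huv hiso
    push Not at hiso
    obtain ⟨y, hyv, hys, hwy⟩ := hiso
    set H := SimpleGraph.fromEdgeSet {z : Sym2 (Fin n) | s ∉ z ∧ w z ≠ 0} with hH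
    have hadj_y : H.Adj v y := by
      rw [hH, SimpleGraph.fromEdgeSet_adj]
      refine ⟨⟨?_, hwy⟩, fun h => hyv h.symm⟩
      rw [Sym2.mem_iff]; push Not; exact ⟨fun h => hvs h.symm, fun h => hys h.symm⟩
    -- every environment pair at `v` is a bridge (no cycle passes through `v`)
    have hbr_of_adj : ∀ x' : Fin n, H.Adj v x' → ¬ (H.deleteEdges {s(v, x')}).Reachable v x' := by
      intro x' hadj
      have hmem : s(v, x') ∈ H.edgeSet := (SimpleGraph.mem_edgeSet (G := H)).2 hadj
      refine SimpleGraph.isBridge_iff.1 ((SimpleGraph.isBridge_iff_forall_cycle_notMem hmem).2 fun x p hp he => ?_)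
      have hv : v ∈ p.support := p.fst_mem_support_of_mem_edges he
      exact hloc (p.takeUntil v hv).reachable.symm p hp
    -- the pair to peel: towards `u` if `u` is in the tree of `v`, anything otherwise
    have hchoice : ∃ x' : Fin n, H.Adj v x' ∧ ¬ (H.deleteEdges {s(v, x')}).Reachable v u := by
      by_cases hr : H.Reachable v u
      · have key : ∀ q : H.Walk v u, q.IsPath → ∃ x' : Fin n, H.Adj v x' ∧ (H.deleteEdges {s(v, x')}).Reachable x' u := by
          intro q hq
          cases q with
          | nil => exact absurd rfl (Ne.symm huv)
          | cons hadj r =>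
            rename_i x'
            refine ⟨x', hadj, SimpleGraph.reachable_deleteEdges_iff_exists_walk.2 ⟨r, fun he => ?_⟩⟩
            exact ((SimpleGraph.Walk.cons_isPath_iff hadj r).1 hq).2 (r.fst_mem_support_of_mem_edges he)
        obtain ⟨p⟩ := hr
        obtain ⟨x', hadj, hreach⟩ := key p.bypass p.bypass_isPath
        exact ⟨x', hadj, fun hvu => hbr_of_adj x' hadj (hvu.trans hreach.symm)⟩
      · exact ⟨y, hadj_y, fun h => hr (h.mono (SimpleGraph.deleteEdges_le _))⟩
    obtain ⟨x', hadj, hxu⟩ := hchoice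
    have hx's : x' ≠ s := by
      intro h
      rw [hH, SimpleGraph.fromEdgeSet_adj] at hadj
      exact hadj.1.1 (h ▸ Sym2.mem_mk_right v x')
    have hbridge : ¬ (H.deleteEdges {s(v, x')}).Reachable v x' := hbr_of_adj x' hadj
    -- the `v`-side of the bridge `s(v, x')`
    set L : Set (Fin n) := {x | (H.deleteEdges {s(v, x')}).Reachable v x}
    have hsL : s ∉ L := apexForest_root_not_mem w hvs _
    have hvL : v ∈ L := SimpleGraph.Reachable.refl v
    have hxL : x' ∉ L := hbridge
    have huL : u ∉ L := hxu
    have hcross : ∀ x y : Fin n, x ∈ L → y ∉ L → y ≠ s → s(x, y) ≠ s(v, x') → w s(x, y) = 0 :=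
      fun x y hx hy hys hne => apexForest_cross w hvs {s(v, x')} hx hy hys (by rwa [Set.mem_singleton_iff])
    -- the pinned weight: fewer positive pairs, and still no cycle through the components of `v` and `x'`
    have hz : s(v, x') ∈ Finset.univ.filter (fun z : Sym2 (Fin n) => ¬ z.IsDiag ∧ s ∉ z ∧ w z ≠ 0) := by
      rw [hH, SimpleGraph.fromEdgeSet_adj] at hadj
      simp only [Finset.mem_filter, Finset.mem_univ, true_and, Sym2.mk_isDiag_iff]
      exact ⟨hadj.2, hadj.1.1, hadj.1.2⟩
    have hle : SimpleGraph.fromEdgeSet {z : Sym2 (Fin n) | s ∉ z ∧ Function.update w s(v, x') 0 z ≠ 0} ≤ H :=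
      envGraph_update_le w s _ 0 (Or.inr rfl)
    have hloc0 : ∀ v' : Fin n, H.Reachable v v' → ∀ ⦃x : Fin n⦄,
        (SimpleGraph.fromEdgeSet {z : Sym2 (Fin n) | s ∉ z ∧ Function.update w s(v, x') 0 z ≠ 0}).Reachable v' x →
        ∀ (p : (SimpleGraph.fromEdgeSet {z : Sym2 (Fin n) | s ∉ z ∧ Function.update w s(v, x') 0 z ≠ 0}).Walk x x), ¬ p.IsCycle :=
      fun v' hv' x hx p hp => hloc (hv'.trans (hx.mono hle)) (p.mapLe hle) (hp.mapLe hle)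
    have hN0 : (Finset.univ.filter fun z : Sym2 (Fin n) => ¬ z.IsDiag ∧ s ∉ z ∧ Function.update w s(v, x') 0 z ≠ 0).card ≤ N := by
      have := posEnv_card_update_lt w s hz; omega
    have IHv := fun u' b' c' => ih (Function.update w s(v, x') 0) u' v b' c' hvs (hloc0 v (SimpleGraph.Reachable.refl v)) hN0
    have IHx := fun u' b' c' => ih (Function.update w s(v, x') 0) u' x' b' c' hx's (hloc0 x' hadj.reachable) hN0
    by_cases hbL : b ∈ L
    · by_cases hcL : c ∈ L
      · exact twoPort_step_AA w L hsL hvL hxL huL hbL hcL hcross (IHv s b c)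
      · exact twoPort_step_AB w L hsL hvL hxL huL hbL hcL hcross (IHx u x' c)
    · by_cases hcL : c ∈ L
      · exact twoPort_step_BA w L hsL hvL hxL huL hbL hcL hcross (IHv s v c)
      · exact twoPort_step_BB w L hsL hvL hxL huL hbL hcL hcross (IHx u b c)

/-- **THE TWO-PORT BRANCH LEMMA (H) on every apex-forest.** [this work] -/
theorem twoPortBranchLemma (w : Sym2 (Fin n) → unitInterval) {s : Fin n} (u v b c : Fin n) (hvs : v ≠ s)
    (hforest : (SimpleGraph.fromEdgeSet {z : Sym2 (Fin n) | s ∉ z ∧ w z ≠ 0}).IsAcyclic) :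
    (prodBernoulli w).real (openConn s u ∩ (openConn s v)ᶜ ∩ openConn b v) *
        (prodBernoulli w).real (openConn s c ∪ openConn u c ∪ openConn v c)
      ≤ (prodBernoulli w).real (openConn s u ∩ (openConn s v)ᶜ ∩ openConn b v ∩ (openConn s c ∪ openConn u c ∪ openConn v c))
        + (prodBernoulli w).real (openConn s u ∩ (openConn s v)ᶜ ∩ openConn b v ∩ (openConn s c ∪ openConn u c)) :=
  twoPortBranchLemma_local w u v b c hvs fun _ _ p => hforest p

end IncStar

end Summit.CriticalPhenomena.PercolationContinuityZ3.Theorems
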